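import Summits.QuantumFields.BalabanUV.Beta.SpineRecursivePureParity

/-!
# `BalabanUV.Beta.GAN24.RespWordsLegAntisymm` — binder row G-an2-4 ∕ (CONV-C), row (C) at the levels `j ≥ 1`, CONTACT side; Part 41 of
# `GAN24/FourFaceGaugeSectors`: **THE RESPONSE WORDS OF THE MEMBER ZERO MODE ARE LEG-ANTISYMMETRIC, HENCE INVISIBLE TO THE
# LEG-AND-BOND SYMMETRISED CHARGE** — question (α) of the g67 junction map («do leaf-04's two RESPONSE words cancel in `LS`?»): YES

NOT IN PRINT; OUR BOOKKEEPING (G-an2-4 crux team (2), leaf prover `b2b-balaban-gan24-formalise-leaf-02`, gen 68).  WHY.  Parts 38 ∕ 40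
(`QuarticMemberCellResolved.zmode_T2RecAt_succ_resolved`, `QuarticMemberTwoLevel.zmode_T2RecAt_succ_twoLevel`) display road-P2's member zero mode
`zmode Lc (T2RecAt … (j+1)) κ κ′ (inl α) (inl β)` as `(cE₂·wV4 (j+1))·(−cH_j²)·( |box|·PAIRFORM_j − ½·RESP_j − ½·|box|·cH_j²·FOURFACE_j )` with the RESPONSE bracket
`RESP_j(κ,κ′;α,β) := Σ_{rr ∈ box} ( Σ'_{u′} Σ'_{(x,z)} 𝟙[x_α ≡ −1]·𝟙[z_β ≡ −1]·dM (K2OfK G_j Lc S_j M_j κ′ u′) Lc S_j M_j κ (toSite rr) x z (inl α)(inl β)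
 + Σ'_{u′} Σ'_{(x,z)} 𝟙[x_α ≡ −1]·𝟙[z_β ≡ −1]·dM (K2OfK G_j Lc S_j M_j κ (toSite rr)) Lc S_j M_j κ′ u′ x z (inl α)(inl β) )`
(`G_j = coDressKBmAt ρ Lc (KInvStep Lc j)`, `S_j = SpureRecAt … j`, `M_j = M1At … j`; Part 40 :73–:77 VERBATIM).  Road-P2's sockets S3 ∕ S4
(`CombChargeAntisymPairForm` `hPair`, `WrecAtEvenHalfRowsOfQLSourcePairForm` `hSrc`) read the LEG-AND-BOND SYMMETRISED charge
`LS_A(κ,κ′;κ₁,κ₂) := A κκ′κ₁κ₂ + A κ′κκ₁κ₂ + (A κκ′κ₂κ₁ + A κ′κκ₂κ₁)`.  THIS FILE: every Lagrangian-chart derivative `dM K′ Lc S_j M_j b` is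
row-parity-ODD for ANY weight kernel `K′` (d1-formalise-leaf-05's `SpineRecursivePureParity.parityOdd_dM_SpureRecAt_M1At`), i.e. its field–field block is
plain-antisymmetric under the exchange of the two legs; re-indexing the face-weighted leg pair sum by `(x,z) ↦ (z,x)` (`Equiv.prodComm`, NO summability
needed) the two response words, their `u′`-sums, and the bracket change sign under `α ↔ β`; so `LS_{RESP_j} = 0` identically — in the symmetrised
currency the member zero mode is `|box|·PAIRFORM_j − ½·|box|·cH_j²·FOURFACE_j` alone (the kernel face of leaf-03 g65's table-level
`SecondOrderCarrierParity.evenHalf_W2SymOfK`: «the second-response word lives entirely in the odd half»; and of gan24-p1's `ZeroModeParity.zmode_sgnK_trK_inl_inl`).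

WHAT ([folklore] BY NAME; 0 `def`, 0 cited facts, 0 `def … : Prop`, 0 sorry; every `j`, in-block root, ANY `Lc ≥ 1`, ANY colour constants):
* §1 generic: `tsum_facePair_swap_of_ff_antisymm` (a kernel whose ff block is leg-antisymmetric has leg-antisymmetric face-weighted pair sums),
  `ff_antisymm_of_parityOdd` (row-parity-odd ⟹ ff block leg-antisymmetric), `legSym_eq_zero_of_swap` (an `α ↔ β`-odd four-index family has zero `LS`).
* §2 at the literal: `respWord_swap` (each response word, `u′`-summed, is `α ↔ β`-odd, for ANY pair of bonds), **`respBracket_swap`** (Part 40's bracket: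
  `RESP_j(κ,κ′;β,α) = −RESP_j(κ,κ′;α,β)`), **`legSym_respBracket_eq_zero`** (`RESP_j κκ′αβ + RESP_j κ′καβ + (RESP_j κκ′βα + RESP_j κ′κβα) = 0`).
* §3 adapter: **`legSym_of_display`** — for any family displayed in Part 38 ∕ 40's literal shape `Z = a·(−(k·(b·P − (½·R + ½·(b·F)))))` with `R` `α ↔ β`-odd,
  `LS_Z = a·(−(k·(b·LS_P − ½·(b·LS_F))))` (finite algebra; the consumer instantiates `hZ` with Part 40 and `hR` with §2 — no import of the unlanded Parts here).
HONEST: NOT IN PRINT — our bookkeeping over OUR typed comb objects; nothing valued; the PAIRFORM bracket's pair antisymmetry (currents — leaf-06's lane) and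
the FOURFACE bracket («T2Shape») are NOT touched; NOTHING of (C) at j ≥ 1 ∕ `hPair` ∕ `hSrc` ∕ `hSrcX` ∕ (C)sym ∕ (Q-L) ∕ (FL) ∕ (HC) ∕ «T2Shape» ∕ «T2Drift» ∕
(hW, hWall) discharged; NEVER «G-an2-4 closed» as (CONV-C); NOT D1, NOT `BetaPertH`, NOT continuum, NOT Clay.  HONEST DEPENDENCY: continuum YM on T⁴ ⇐
BetaPertH ∧ nine spine estimates (0/9 proved); BetaPertH ⇐ (D1) ∧ (D4) ∧ CAP+tail; G-an2-4 gates asym, D1 and NE2/3/4.  2026-08-24; no existing file touched.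
-/

noncomputable section

open Finset
open scoped BigOperators
open Literature.MathematicalPhysics.QuantumFieldTheory
open Literature.MathematicalPhysics.QuantumFieldTheory.Balaban1983to89
open Literature.MathematicalPhysics.QuantumFieldTheory.Balaban1983to89.Beta
open ExpKernelCalculus (Site MKer)
open OneStepResolventKernel (Fib)
open AffineAveraging (box toSite)
open OneStepKernelFamily (KInvStep)
open SecondOrderResponse (dM K2OfK)
open Summit.QuantumFields.BalabanUV.Beta.TameKernelCalculus
open Summit.QuantumFields.BalabanUV.Beta.BorderedHessian (sgnF sgnF_inl sgnK sgnK_apply)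
open Summit.QuantumFields.BalabanUV.Beta.AxialDressingRooted (coDressKBmAt)
open Summit.QuantumFields.BalabanUV.Beta.SpineRooted (SpureRecAt M1At)
open Summit.QuantumFields.BalabanUV.Beta.SpineRecursivePureParity (parityOdd_dM_SpureRecAt_M1At)

namespace Summit.QuantumFields.BalabanUV.Beta.GAN24.RespWordsLegAntisymm

variable {d : ℕ}

/-! ## §1 Generic: leg-antisymmetric ff blocks have leg-antisymmetric face-weighted pair sums -/

/-- [folklore] **FACE-WEIGHTED LEG PAIR SUMS OF A LEG-ANTISYMMETRIC ff BLOCK ARE `α ↔ β`-ODD**: if `D z x (inl β) (inl α) = −D x z (inl α) (inl β)` for all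
`x z`, then `Σ'_{(x,z)} 𝟙[x_β ≡ −1]·𝟙[z_α ≡ −1]·D x z (inl β)(inl α) = −Σ'_{(x,z)} 𝟙[x_α ≡ −1]·𝟙[z_β ≡ −1]·D x z (inl α)(inl β)` (re-index the pair by the
swap — an equivalence, so NO summability is needed). -/
theorem tsum_facePair_swap_of_ff_antisymm (N : ℤ) {D : MKer (d + 1) (Fib d)} {α β : Fin (d + 1)}
    (hD : ∀ x z : Site (d + 1), D z x (Sum.inl β) (Sum.inl α) = -D x z (Sum.inl α) (Sum.inl β)) :
    ∑' xz : Site (d + 1) × Site (d + 1), (if xz.1 β % N = N - 1 then (1 : ℝ) else 0) * (if xz.2 α % N = N - 1 then (1 : ℝ) else 0) *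
        D xz.1 xz.2 (Sum.inl β) (Sum.inl α)
      = -∑' xz : Site (d + 1) × Site (d + 1), (if xz.1 α % N = N - 1 then (1 : ℝ) else 0) * (if xz.2 β % N = N - 1 then (1 : ℝ) else 0) *
        D xz.1 xz.2 (Sum.inl α) (Sum.inl β) := by
  rw [← tsum_neg, ← (Equiv.prodComm (Site (d + 1)) (Site (d + 1))).tsum_eq]
  refine tsum_congr fun xz => ?_
  simp only [Equiv.prodComm_apply, Prod.fst_swap, Prod.snd_swap]
  rw [hD xz.1 xz.2]
  ring

/-- [folklore] **A ROW-PARITY-ODD KERNEL HAS A LEG-ANTISYMMETRIC ff BLOCK** (`sgnF (inl ·) = 1`). -/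
theorem ff_antisymm_of_parityOdd {D : MKer (d + 1) (Fib d)} (h : trK D = -sgnK D) (x z : Site (d + 1)) (α β : Fin (d + 1)) :
    D z x (Sum.inl β) (Sum.inl α) = -D x z (Sum.inl α) (Sum.inl β) := by
  have h1 := congrFun (congrFun (congrFun (congrFun h x) z) (Sum.inl α)) (Sum.inl β)
  simp only [trK_apply, Pi.neg_apply, sgnK_apply, sgnF_inl, one_mul] at h1
  exact h1

/-- [folklore] **AN `α ↔ β`-ODD FOUR-INDEX FAMILY HAS ZERO LEG-AND-BOND SYMMETRISED CHARGE** (road-P2 F9's `LS` shape VERBATIM). -/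
theorem legSym_eq_zero_of_swap {ι : Type*} {B : ι → ι → ι → ι → ℝ} (h : ∀ κ κ' α β, B κ κ' β α = -B κ κ' α β) (κ κ' α β : ι) :
    B κ κ' α β + B κ' κ α β + (B κ κ' β α + B κ' κ β α) = 0 := by
  rw [h κ κ' α β, h κ' κ α β]
  ring

/-! ## §2 At the literal: the response words of Parts 38 ∕ 40 -/

section Literal

variable {Lc : ℕ} [NeZero Lc] {r : Fin (d + 1) → ℕ}

/-- NOT IN PRINT; OUR BOOKKEEPING.  **EACH RESPONSE WORD IS `α ↔ β`-ODD** (every `j`, in-block root, ANY two bonds `(μ,y)`, `(ν,y′)`): the `u′`-free statement —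
the face-weighted leg pair sum of `dM (K2OfK G_j Lc S_j M_j ν y′) Lc S_j M_j μ y` changes sign under the exchange of the two leg directions (the kernel is
row-parity-odd for ANY weight kernel: `parityOdd_dM_SpureRecAt_M1At`). -/
theorem respWord_pair_swap (hLc : 1 ≤ Lc) (hr : r ∈ box (d + 1) Lc) (cE cVH cΛ : ℝ) (j : ℕ) (K' : MKer (d + 1) (Fib d))
    (μ : Fin (d + 1)) (y : Site (d + 1)) (α β : Fin (d + 1)) :
    ∑' xz : Site (d + 1) × Site (d + 1), (if xz.1 β % (Lc : ℤ) = (Lc : ℤ) - 1 then (1 : ℝ) else 0) * (if xz.2 α % (Lc : ℤ) = (Lc : ℤ) - 1 then (1 : ℝ) else 0) *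
        dM K' Lc (SpureRecAt d Lc (toSite r) cE cVH cΛ j) (M1At d Lc (toSite r) cΛ j) μ y xz.1 xz.2 (Sum.inl β) (Sum.inl α)
      = -∑' xz : Site (d + 1) × Site (d + 1), (if xz.1 α % (Lc : ℤ) = (Lc : ℤ) - 1 then (1 : ℝ) else 0) * (if xz.2 β % (Lc : ℤ) = (Lc : ℤ) - 1 then (1 : ℝ) else 0) *
        dM K' Lc (SpureRecAt d Lc (toSite r) cE cVH cΛ j) (M1At d Lc (toSite r) cΛ j) μ y xz.1 xz.2 (Sum.inl α) (Sum.inl β) :=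
  tsum_facePair_swap_of_ff_antisymm (Lc : ℤ) fun x z =>
    ff_antisymm_of_parityOdd (parityOdd_dM_SpureRecAt_M1At hLc hr cE cVH cΛ cΛ j j K' μ y) x z α β

/-- NOT IN PRINT; OUR BOOKKEEPING.  **THE `u′`-SUMMED RESPONSE WORD IS `α ↔ β`-ODD** — the inner word of Part 40's bracket (weight kernel `K2OfK G_j Lc S_j M_j κ′ u′`,
outer bond `(κ, y)`), summed over the second slot `u′` (`tsum_neg`; NO summability needed). -/
theorem respWordIn_swap (hLc : 1 ≤ Lc) (hr : r ∈ box (d + 1) Lc) (cE cVH cΛ : ℝ) (j : ℕ) (κ : Fin (d + 1)) (y : Site (d + 1)) (κ' α β : Fin (d + 1)) :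
    ∑' u' : Site (d + 1), ∑' xz : Site (d + 1) × Site (d + 1), (if xz.1 β % (Lc : ℤ) = (Lc : ℤ) - 1 then (1 : ℝ) else 0) * (if xz.2 α % (Lc : ℤ) = (Lc : ℤ) - 1 then (1 : ℝ) else 0) *
        dM (K2OfK (coDressKBmAt (toSite r) Lc (KInvStep (d := d) Lc j)) Lc (SpureRecAt d Lc (toSite r) cE cVH cΛ j) (M1At d Lc (toSite r) cΛ j) κ' u') Lc
          (SpureRecAt d Lc (toSite r) cE cVH cΛ j) (M1At d Lc (toSite r) cΛ j) κ y xz.1 xz.2 (Sum.inl β) (Sum.inl α)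
      = -∑' u' : Site (d + 1), ∑' xz : Site (d + 1) × Site (d + 1), (if xz.1 α % (Lc : ℤ) = (Lc : ℤ) - 1 then (1 : ℝ) else 0) * (if xz.2 β % (Lc : ℤ) = (Lc : ℤ) - 1 then (1 : ℝ) else 0) *
        dM (K2OfK (coDressKBmAt (toSite r) Lc (KInvStep (d := d) Lc j)) Lc (SpureRecAt d Lc (toSite r) cE cVH cΛ j) (M1At d Lc (toSite r) cΛ j) κ' u') Lc
          (SpureRecAt d Lc (toSite r) cE cVH cΛ j) (M1At d Lc (toSite r) cΛ j) κ y xz.1 xz.2 (Sum.inl α) (Sum.inl β) := by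
  rw [← tsum_neg]
  exact tsum_congr fun u' => respWord_pair_swap hLc hr cE cVH cΛ j _ κ y α β

/-- NOT IN PRINT; OUR BOOKKEEPING.  **THE `u′`-SUMMED OUTER RESPONSE WORD IS `α ↔ β`-ODD** — the outer word of Part 40's bracket (weight kernel
`K2OfK G_j Lc S_j M_j κ y`, outer bond `(κ′, u′)` summed). -/
theorem respWordOut_swap (hLc : 1 ≤ Lc) (hr : r ∈ box (d + 1) Lc) (cE cVH cΛ : ℝ) (j : ℕ) (κ : Fin (d + 1)) (y : Site (d + 1)) (κ' α β : Fin (d + 1)) :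
    ∑' u' : Site (d + 1), ∑' xz : Site (d + 1) × Site (d + 1), (if xz.1 β % (Lc : ℤ) = (Lc : ℤ) - 1 then (1 : ℝ) else 0) * (if xz.2 α % (Lc : ℤ) = (Lc : ℤ) - 1 then (1 : ℝ) else 0) *
        dM (K2OfK (coDressKBmAt (toSite r) Lc (KInvStep (d := d) Lc j)) Lc (SpureRecAt d Lc (toSite r) cE cVH cΛ j) (M1At d Lc (toSite r) cΛ j) κ y) Lc
          (SpureRecAt d Lc (toSite r) cE cVH cΛ j) (M1At d Lc (toSite r) cΛ j) κ' u' xz.1 xz.2 (Sum.inl β) (Sum.inl α)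
      = -∑' u' : Site (d + 1), ∑' xz : Site (d + 1) × Site (d + 1), (if xz.1 α % (Lc : ℤ) = (Lc : ℤ) - 1 then (1 : ℝ) else 0) * (if xz.2 β % (Lc : ℤ) = (Lc : ℤ) - 1 then (1 : ℝ) else 0) *
        dM (K2OfK (coDressKBmAt (toSite r) Lc (KInvStep (d := d) Lc j)) Lc (SpureRecAt d Lc (toSite r) cE cVH cΛ j) (M1At d Lc (toSite r) cΛ j) κ y) Lc
          (SpureRecAt d Lc (toSite r) cE cVH cΛ j) (M1At d Lc (toSite r) cΛ j) κ' u' xz.1 xz.2 (Sum.inl α) (Sum.inl β) := by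
  rw [← tsum_neg]
  exact tsum_congr fun u' => respWord_pair_swap hLc hr cE cVH cΛ j _ κ' u' α β

/-- NOT IN PRINT; OUR BOOKKEEPING.  **PART 40's RESPONSE BRACKET IS `α ↔ β`-ODD**: `RESP_j(κ,κ′;β,α) = −RESP_j(κ,κ′;α,β)` — the bracket of
`QuarticMemberTwoLevel.zmode_T2RecAt_succ_twoLevel` :73–:77 (and of Part 38) VERBATIM, every `j`, in-block root, ANY colour constants. -/
theorem respBracket_swap (hLc : 1 ≤ Lc) (hr : r ∈ box (d + 1) Lc) (cE cVH cΛ : ℝ) (j : ℕ) (κ κ' α β : Fin (d + 1)) :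
    ∑ rr ∈ box (d + 1) Lc,
        ((∑' u' : Site (d + 1), ∑' xz : Site (d + 1) × Site (d + 1), (if xz.1 β % (Lc : ℤ) = (Lc : ℤ) - 1 then (1 : ℝ) else 0) * (if xz.2 α % (Lc : ℤ) = (Lc : ℤ) - 1 then (1 : ℝ) else 0) *
          dM (K2OfK (coDressKBmAt (toSite r) Lc (KInvStep (d := d) Lc j)) Lc (SpureRecAt d Lc (toSite r) cE cVH cΛ j) (M1At d Lc (toSite r) cΛ j) κ' u') Lc (SpureRecAt d Lc (toSite r) cE cVH cΛ j) (M1At d Lc (toSite r) cΛ j) κ (toSite rr) xz.1 xz.2 (Sum.inl β) (Sum.inl α))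
        + ∑' u' : Site (d + 1), ∑' xz : Site (d + 1) × Site (d + 1), (if xz.1 β % (Lc : ℤ) = (Lc : ℤ) - 1 then (1 : ℝ) else 0) * (if xz.2 α % (Lc : ℤ) = (Lc : ℤ) - 1 then (1 : ℝ) else 0) *
          dM (K2OfK (coDressKBmAt (toSite r) Lc (KInvStep (d := d) Lc j)) Lc (SpureRecAt d Lc (toSite r) cE cVH cΛ j) (M1At d Lc (toSite r) cΛ j) κ (toSite rr)) Lc (SpureRecAt d Lc (toSite r) cE cVH cΛ j) (M1At d Lc (toSite r) cΛ j) κ' u' xz.1 xz.2 (Sum.inl β) (Sum.inl α))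
      = -∑ rr ∈ box (d + 1) Lc,
        ((∑' u' : Site (d + 1), ∑' xz : Site (d + 1) × Site (d + 1), (if xz.1 α % (Lc : ℤ) = (Lc : ℤ) - 1 then (1 : ℝ) else 0) * (if xz.2 β % (Lc : ℤ) = (Lc : ℤ) - 1 then (1 : ℝ) else 0) *
          dM (K2OfK (coDressKBmAt (toSite r) Lc (KInvStep (d := d) Lc j)) Lc (SpureRecAt d Lc (toSite r) cE cVH cΛ j) (M1At d Lc (toSite r) cΛ j) κ' u') Lc (SpureRecAt d Lc (toSite r) cE cVH cΛ j) (M1At d Lc (toSite r) cΛ j) κ (toSite rr) xz.1 xz.2 (Sum.inl α) (Sum.inl β))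
        + ∑' u' : Site (d + 1), ∑' xz : Site (d + 1) × Site (d + 1), (if xz.1 α % (Lc : ℤ) = (Lc : ℤ) - 1 then (1 : ℝ) else 0) * (if xz.2 β % (Lc : ℤ) = (Lc : ℤ) - 1 then (1 : ℝ) else 0) *
          dM (K2OfK (coDressKBmAt (toSite r) Lc (KInvStep (d := d) Lc j)) Lc (SpureRecAt d Lc (toSite r) cE cVH cΛ j) (M1At d Lc (toSite r) cΛ j) κ (toSite rr)) Lc (SpureRecAt d Lc (toSite r) cE cVH cΛ j) (M1At d Lc (toSite r) cΛ j) κ' u' xz.1 xz.2 (Sum.inl α) (Sum.inl β)) := by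
  rw [← Finset.sum_neg_distrib]
  refine Finset.sum_congr rfl fun rr _ => ?_
  rw [respWordIn_swap hLc hr cE cVH cΛ j κ (toSite rr) κ' α β, respWordOut_swap hLc hr cE cVH cΛ j κ (toSite rr) κ' α β]
  ring

/-- NOT IN PRINT; OUR BOOKKEEPING.  **THE RESPONSE BRACKET HAS ZERO LEG-AND-BOND SYMMETRISED CHARGE** — question (α) of the g67 junction map answered:
with `RESP_j(κ,κ′;α,β)` Part 40's bracket, `RESP_j κκ′αβ + RESP_j κ′καβ + (RESP_j κκ′βα + RESP_j κ′κβα) = 0` (road-P2 F9's `LS` shape); in road-P2's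
symmetrised sockets the member zero mode at level `j+1` is `|box|·PAIRFORM_j − ½·|box|·cH_j²·FOURFACE_j` (times `(cE₂·wV4 (j+1))·(−cH_j²)`) alone. -/
theorem legSym_respBracket_eq_zero (hLc : 1 ≤ Lc) (hr : r ∈ box (d + 1) Lc) (cE cVH cΛ : ℝ) (j : ℕ) (κ κ' α β : Fin (d + 1)) :
    let RESP : Fin (d + 1) → Fin (d + 1) → Fin (d + 1) → Fin (d + 1) → ℝ := fun κ κ' α β =>
      ∑ rr ∈ box (d + 1) Lc,
        ((∑' u' : Site (d + 1), ∑' xz : Site (d + 1) × Site (d + 1), (if xz.1 α % (Lc : ℤ) = (Lc : ℤ) - 1 then (1 : ℝ) else 0) * (if xz.2 β % (Lc : ℤ) = (Lc : ℤ) - 1 then (1 : ℝ) else 0) *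
          dM (K2OfK (coDressKBmAt (toSite r) Lc (KInvStep (d := d) Lc j)) Lc (SpureRecAt d Lc (toSite r) cE cVH cΛ j) (M1At d Lc (toSite r) cΛ j) κ' u') Lc (SpureRecAt d Lc (toSite r) cE cVH cΛ j) (M1At d Lc (toSite r) cΛ j) κ (toSite rr) xz.1 xz.2 (Sum.inl α) (Sum.inl β))
        + ∑' u' : Site (d + 1), ∑' xz : Site (d + 1) × Site (d + 1), (if xz.1 α % (Lc : ℤ) = (Lc : ℤ) - 1 then (1 : ℝ) else 0) * (if xz.2 β % (Lc : ℤ) = (Lc : ℤ) - 1 then (1 : ℝ) else 0) *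
          dM (K2OfK (coDressKBmAt (toSite r) Lc (KInvStep (d := d) Lc j)) Lc (SpureRecAt d Lc (toSite r) cE cVH cΛ j) (M1At d Lc (toSite r) cΛ j) κ (toSite rr)) Lc (SpureRecAt d Lc (toSite r) cE cVH cΛ j) (M1At d Lc (toSite r) cΛ j) κ' u' xz.1 xz.2 (Sum.inl α) (Sum.inl β))
    RESP κ κ' α β + RESP κ' κ α β + (RESP κ κ' β α + RESP κ' κ β α) = 0 := by
  intro RESP
  exact legSym_eq_zero_of_swap (B := RESP) (fun κ κ' α β => respBracket_swap hLc hr cE cVH cΛ j κ κ' α β) κ κ' α β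

end Literal

/-! ## §3 The symmetrised display with the response bracket gone (adapter for the consumers of Parts 38 ∕ 40) -/

/-- NOT IN PRINT; OUR BOOKKEEPING ([folklore] finite algebra).  **THE LEG-AND-BOND SYMMETRISED MEMBER DISPLAY HAS NO RESPONSE BRACKET**: if a four-index family is
displayed as `Z κκ′αβ = a·(−(k·(b·P κκ′αβ − (½·R κκ′αβ + ½·(b·F κκ′αβ)))))` (the literal shape of Part 38 `zmode_T2RecAt_succ_resolved` ∕ Part 40 `zmode_T2RecAt_succ_twoLevel(′)` with
`Z` = road-P2's member zero mode at level `j+1`, `P` = the pair-form bracket, `R` = the response bracket, `F` = the four-face ∕ two-level bracket, `b = |box|`,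
`a = cE₂·wV4 (j+1)`, `k = cH_j²`) and `R` is `α ↔ β`-odd (`respBracket_swap`), then
`LS_Z = a·(−(k·(b·LS_P − ½·(b·LS_F))))` in road-P2 F9's `LS` shape — instantiate `hZ` with Part 40 and `hR` with §2. -/
theorem legSym_of_display {ι : Type*} {Z P R F : ι → ι → ι → ι → ℝ} {a k b : ℝ}
    (hZ : ∀ κ κ' α β, Z κ κ' α β = a * -(k * (b * P κ κ' α β - ((1 / 2 : ℝ) * R κ κ' α β + (1 / 2 : ℝ) * (b * F κ κ' α β)))))
    (hR : ∀ κ κ' α β, R κ κ' β α = -R κ κ' α β) (κ κ' α β : ι) :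
    Z κ κ' α β + Z κ' κ α β + (Z κ κ' β α + Z κ' κ β α)
      = a * -(k * (b * (P κ κ' α β + P κ' κ α β + (P κ κ' β α + P κ' κ β α))
          - (1 / 2 : ℝ) * (b * (F κ κ' α β + F κ' κ α β + (F κ κ' β α + F κ' κ β α))))) := by
  rw [hZ κ κ' α β, hZ κ' κ α β, hZ κ κ' β α, hZ κ' κ β α, hR κ κ' α β, hR κ' κ α β]
  ring

end Summit.QuantumFields.BalabanUV.Beta.GAN24.RespWordsLegAntisymm

end
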